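import Mathlib
import HarnessLib
import Summits.NavierStokesRegularity.NavierStokesRegularity.Theorems.PoloidalWindowDoorLrcModEntireRidgeQuasiconvex
import Summits.NavierStokesRegularity.NavierStokesRegularity.Theorems.PoloidalWindowDoorLrcModEntireLateralLevel
import Summits.NavierStokesRegularity.NavierStokesRegularity.Theorems.PoloidalWindowDoorLrcModEntireRidgeAssembly
import Summits.NavierStokesRegularity.NavierStokesRegularity.Theorems.PoloidalWindowDoorLrcModEntireTwistingTHFlatLever

/-!
# Item `LrcModEntire` (stmt-NavierStokesRegularity-20428), registry twist_split v8 — THE FLAT LEVER ASSEMBLED (memo `Cruxes/LrcModEntire/T2B-g15.md` §17c):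
# Peakless + joint continuity + a tube chart around a FLAT hot arc + uniform QUARTIC cross-section data ⇒ the quartic deficit coefficient `m(s) = min_η Q_s(η,1)` is QUASICONCAVE along the arc
LEAD of item 20428 ns-poloidal-K2-p3 g15 (`--supports stmt-NavierStokesRegularity-20428 --as helper`).  The flat twin of `…RidgeAssembly.quasiconvexOn_ridgeCoeff_of_peakless`
(κ > 0 lever, LEAD g14): composition of (Q1) `…RidgeQuasiconvex.crossSectionMax_quasiconvexOn_of_peakless`, (LL) `…LateralLevel.lateralLevel_persist`, and the flat rungs of
`…TwistingTHFlatLever` — (F-i) `abs_sSup_sub_le_of_quarticRidgeExpansion'` (the quartic tube) and (F-ii) `quasiconcaveOn_coeff_of_expansion_pow`; the Taylor input `hexp` is the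
conclusion of (F-H) `…TwistingTHFlatTaylor.quarticRidgeExpansion_of_flatPoint` at every point of a flat hot arc (first three derivatives of `σv₂(−1,·)` vanish: the flat sub-cell
`stub_T2bFlat`, `…FlatRidgeJet` / `…FlatRidgeCubic`), with the class bound `‖D⁵v(−1)‖ ≤ C₅`.
* `quasiconcaveOn_quarticCoeff_of_peakless` — Peakless VERBATIM, `v` jointly continuous on the backward slab, a tube chart `e` with cold lateral sides / hot centre at time −1 on the
  thread plane, a family of degree-4-homogeneous forms `Q_s` (`Q_s(ηt,t) = t⁴Q_s(η,1)`) uniformly definite (`λ(n⁴+z⁴) ≤ Q_s`) whose minimum `m(s) = min_η Q_s(η,1)` is attained at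
  `|η₀(s)| ≤ K`, `|m| ≤ Mb`, a thin tube `64Cr ≤ λ`, and the expansion `|σv₂(−1, tube point at height z) − (N − Q_s(n,z))| ≤ C(|n|+|z|)⁵` ⇒ **`m` is quasiconcave on the parameter
  interval**: the transversal quartic deficit of a flat ridge has no strict interior local minimum along it (memo §17c; e.g. no transversal crossing next to definite points).
WHAT THIS IS NOT: not a claim about Navier–Stokes regularity and not a proof of `stub_T2bFlat` — the κ-free lever, class-free in the ridge data (bears_on LADDER-NS N0, item 20428 /
crux 19708; OPEN, ⟨27893⟩ OPEN).
-/

noncomputable section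

set_option linter.style.longLine false
-- the summit and its single sub-problem share the name (CONVENTIONS §1), as in every Theorems file
set_option linter.dupNamespace false

namespace Summit.NavierStokesRegularity.NavierStokesRegularity.Theorems.PoloidalWindowDoorLrcModEntireTwistingTHFlatAssembly

open Set Filter Topology Metric Function
open Summit.NavierStokesRegularity.NavierStokesRegularity.Theorems.PoloidalWindowDoorLrcModEntireRidgeQuasiconvex
open Summit.NavierStokesRegularity.NavierStokesRegularity.Theorems.PoloidalWindowDoorLrcModEntireLateralLevel
open Summit.NavierStokesRegularity.NavierStokesRegularity.Theorems.PoloidalWindowDoorLrcModEntireRidgeAssembly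
open Summit.NavierStokesRegularity.NavierStokesRegularity.Theorems.PoloidalWindowDoorLrcModEntireTwistingTHFlatLever

variable {v : ℝ → EuclideanSpace ℝ (Fin 3) → EuclideanSpace ℝ (Fin 3)}

/-- **THE QUARTIC DEFICIT COEFFICIENT IS QUASICONCAVE ALONG A FLAT HOT ARC.**  See the module docstring. -/
theorem quasiconcaveOn_quarticCoeff_of_peakless
    (hpk : ∀ (s z₀ σ M : ℝ) (K O : Set (EuclideanSpace ℝ (Fin 3))), s < 0 →
      ((σ = 1 ∨ σ = -1) ∧ IsCompact K ∧ K.Nonempty ∧ (∀ y ∈ K, y 2 = z₀ ∧ σ * v s y 2 = M) ∧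
        IsOpen O ∧ K ⊆ O ∧ (∀ y ∈ O, y 2 = z₀ → σ * v s y 2 ≤ M) ∧
        (∀ y ∈ O, y 2 = z₀ → σ * v s y 2 = M → y ∈ K)) → False)
    (hcont : ContinuousOn (uncurry v) (Iio (0 : ℝ) ×ˢ univ)) {σ N : ℝ} (hσ : σ = 1 ∨ σ = -1)
    (e : OpenPartialHomeomorph (ℝ × ℝ) (ℝ × ℝ)) {a₁ a₂ r : ℝ} (ha : a₁ ≤ a₂) (hr : 0 < r) (hsrc : Icc a₁ a₂ ×ˢ Icc (-r) r ⊆ e.source)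
    {P : ℝ → ℝ × ℝ → EuclideanSpace ℝ (Fin 3)} (hP : ∀ z₀ q, P z₀ q = WithLp.toLp 2 ![q.1, q.2, z₀])
    (hlat0 : ∀ a ∈ Icc a₁ a₂, ∀ n : ℝ, (n = r ∨ n = -r) → σ * v (-1) (P 0 (e (a, n))) 2 < N)
    (hmid0 : ∀ a ∈ Icc a₁ a₂, σ * v (-1) (P 0 (e (a, 0))) 2 = N)
    {Q : ℝ → ℝ → ℝ → ℝ} {m η₀ : ℝ → ℝ} {lam K Mb C : ℝ} (hlam : 0 < lam) (hC : 0 ≤ C) (hK : 0 ≤ K) (hthin : 64 * C * r ≤ lam)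
    (hhom : ∀ s ∈ Icc a₁ a₂, ∀ η t : ℝ, Q s (η * t) t = t ^ 4 * Q s η 1)
    (hdef : ∀ s ∈ Icc a₁ a₂, ∀ n z : ℝ, lam * (n ^ 4 + z ^ 4) ≤ Q s n z)
    (hmin : ∀ s ∈ Icc a₁ a₂, ∀ η : ℝ, m s ≤ Q s η 1) (hη₀ : ∀ s ∈ Icc a₁ a₂, Q s (η₀ s) 1 = m s)
    (hη₀K : ∀ s ∈ Icc a₁ a₂, |η₀ s| ≤ K) (hMb : ∀ s ∈ Icc a₁ a₂, |m s| ≤ Mb)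
    (hexp : ∀ s ∈ Icc a₁ a₂, ∀ n z : ℝ,
      |σ * v (-1) (P z (e (s, n))) 2 - (N - Q s n z)| ≤ C * (|n| + |z|) ^ 5) :
    QuasiconcaveOn ℝ (Icc a₁ a₂) m := by
  -- (LL): the tube level for all nearby heights at time `−1`
  obtain ⟨δ, hδ, mm, hLL⟩ := lateralLevel_persist hcont e ha hsrc hr.le hP hlat0 hmid0
  have hvc : Continuous fun y : EuclideanSpace ℝ (Fin 3) => v (-1) y 2 := continuous_slice_two hcont (by norm_num)
  -- the cross-section maximum `R s z`
  set R : ℝ → ℝ → ℝ := fun s z => sSup ((fun n : ℝ => σ * v (-1) (P z (e (s, n))) 2) '' Icc (-r) r) with hR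
  -- the admissible height range: `0 < z ≤ δ'` with `δ' < δ`, `δ' ≤ 1`, `K δ' ≤ r`
  set δ' : ℝ := min (min (δ / 2) 1) (r / (K + 1)) with hδ'
  have hδ'0 : 0 < δ' := lt_min (lt_min (by linarith) one_pos) (by positivity)
  have hδ'δ : δ' < δ := lt_of_le_of_lt ((min_le_left _ _).trans (min_le_left _ _)) (by linarith)
  have hδ'1 : δ' ≤ 1 := (min_le_left _ _).trans (min_le_right _ _)
  have hδ'K : δ' ≤ r / (K + 1) := min_le_right _ _
  -- (Q1): quasiconvexity of `s ↦ R s z` for `0 < z ≤ δ'`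
  have hqc : ∀ z : ℝ, 0 < z → z ≤ δ' → QuasiconvexOn ℝ (Icc a₁ a₂) fun s => R s z := by
    intro z hz hzδ'
    have hzabs : |z| < δ := by rw [abs_of_pos hz]; exact lt_of_le_of_lt hzδ' hδ'δ
    obtain ⟨hlat, hmid⟩ := hLL (-1) z (by norm_num [hδ]) hzabs
    exact crossSectionMax_quasiconvexOn_of_peakless hpk (by norm_num) hσ hvc (hP z) e hr.le hsrc hlat hmid
  -- (F-i): the uniform expansion of `R s z`
  set B : ℝ := max 1 (2 * (Mb + 32 * C + C * (K + 1) ^ 5) / lam) with hB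
  set C' : ℝ := C * (K + 1) ^ 5 + C * (B + 1) ^ 5 with hC'
  have hexpR : ∀ s ∈ Icc a₁ a₂, ∀ z : ℝ, 0 < z → z ≤ δ' → |R s z - N + m s * z ^ 4| ≤ C' * z ^ (4 + 1) := by
    intro s hs z hz0 hzδ'
    have hzabs : |z| = z := abs_of_pos hz0
    -- continuity of the cross-sections at every height
    have hsec : ∀ z' : ℝ, |z'| ≤ |z| → ContinuousOn (fun n : ℝ => σ * v (-1) (P z' (e (s, n))) 2) (Icc (-r) r) := by
      intro z' _
      have hPc : Continuous (P z') := by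
        have : P z' = fun q => WithLp.toLp 2 ![q.1, q.2, z'] := funext (hP z')
        rw [this]
        refine (PiLp.continuous_toLp 2 _).comp (continuous_pi fun i => ?_)
        fin_cases i <;> simp <;> fun_prop
      have hline : ContinuousOn (fun n : ℝ => e (s, n)) (Icc (-r) r) :=
        e.continuousOn.comp (Continuous.continuousOn (by fun_prop)) fun n hn => hsrc ⟨hs, hn⟩
      exact continuousOn_const.mul ((hvc.comp hPc).comp_continuousOn hline)
    have hz1 : |z| ≤ 1 := by rw [hzabs]; exact hzδ'.trans hδ'1
    have hKz : K * |z| ≤ r := by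
      rw [hzabs]
      have h1 : K * z ≤ K * (r / (K + 1)) := mul_le_mul_of_nonneg_left (hzδ'.trans hδ'K) hK
      have h2 : K * (r / (K + 1)) ≤ r := by
        rw [mul_div_assoc', div_le_iff₀ (by linarith)]; nlinarith [hr.le]
      exact h1.trans h2
    have h := abs_sSup_sub_le_of_quarticRidgeExpansion' (g := fun n z' => σ * v (-1) (P z' (e (s, n))) 2) (Q := Q s) (δ := |z|)
      (hhom s hs) hlam (hdef s hs) (hmin s hs) (hη₀ s hs) (hη₀K s hs) hC hr hthin (fun n z' _ _ => hexp s hs n z') hsec (le_refl |z|) hz1 hKz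
    -- uniformise the constant: `|m s| ≤ Mb` makes the seat's `B(s)` at most `B`
    have hBs : max 1 (2 * (|m s| + 32 * C + C * (K + 1) ^ 5) / lam) ≤ B := by
      rw [hB]
      refine max_le_max le_rfl (div_le_div_of_nonneg_right ?_ hlam.le)
      nlinarith [hMb s hs]
    have hB0 : 0 ≤ max 1 (2 * (|m s| + 32 * C + C * (K + 1) ^ 5) / lam) := zero_le_one.trans (le_max_left _ _)
    have hcoef : (C * (K + 1) ^ 5 + C * (max 1 (2 * (|m s| + 32 * C + C * (K + 1) ^ 5) / lam) + 1) ^ 5) * |z| ^ 5 ≤ C' * z ^ (4 + 1) := by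
      rw [hzabs, hC']
      refine mul_le_mul_of_nonneg_right ?_ (by positivity)
      have h5 : (max 1 (2 * (|m s| + 32 * C + C * (K + 1) ^ 5) / lam) + 1) ^ 5 ≤ (B + 1) ^ 5 :=
        pow_le_pow_left₀ (by positivity) (by linarith) 5
      nlinarith [mul_le_mul_of_nonneg_left h5 hC]
    have e1 : R s z - N + m s * z ^ 4 = R s z - (N - m s * z ^ 4) := by ring
    rw [e1]
    exact h.trans hcoef
  -- (F-ii): pass to the coefficient
  exact quasiconcaveOn_coeff_of_expansion_pow (convex_Icc a₁ a₂) hδ'0 4 hexpR hqc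

end Summit.NavierStokesRegularity.NavierStokesRegularity.Theorems.PoloidalWindowDoorLrcModEntireTwistingTHFlatAssembly

end
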